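import Summits.Ventures.QEC.Census.CertBZPlane
import Summits.Ventures.QEC.Census.TwoBGA.A2h_n224_k12_c3f6e83f.Cert
import HarnessLib

/-!
# `A2h_n224_k12_c3f6e83f` — lane-engine replays, part 8/8 (census row `A2h_n224_k12_c3f6e83f`; qec-search-4 orbit lane, emitted by qec-type-08 g7)

`Plane.segOK` verdicts (type-01 lane engine, `decide +kernel`) for segments of the kernel-basis replays of the views of
`Census/TwoBGA/A2h_n224_k12_c3f6e83f/`; assembled in `Distance.lean`.  Generated by `tools/gen4/emit_orbit_row.py`; do not edit by hand.
-/

set_option autoImplicit false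
set_option Elab.async false

namespace Summit.Ventures.QEC.Census.A2h_n224_k12_c3f6e83f

open Summit.Ventures.QEC.Census

set_option maxHeartbeats 400000000 in
/-- `X` view 0, lane segment `[111, 112)` (6217037 lanes, depth 5, threshold 11; est 26 s): every selection with largest row there passes (lane engine, KERNEL). -/
theorem psegX_0_27 : Plane.segOK 224 11 (A2h_n224_k12_c3f6e83f.cert.sideX.found.map Prod.fst) A2h_n224_k12_c3f6e83f.pGX_0 5 111 1 47 = true := by
  decide +kernel

set_option maxHeartbeats 400000000 in
/-- `X` view 0, lane segment `[112, 113)` (6445069 lanes, depth 5, threshold 11; est 20 s): every selection with largest row there passes (lane engine, KERNEL). -/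
theorem psegX_0_28 : Plane.segOK 224 11 (A2h_n224_k12_c3f6e83f.cert.sideX.found.map Prod.fst) A2h_n224_k12_c3f6e83f.pGX_0 5 112 1 47 = true := by
  decide +kernel

set_option maxHeartbeats 400000000 in
/-- `X` view 0, lane segment `[113, 114)` (6679318 lanes, depth 5, threshold 11; est 29 s): every selection with largest row there passes (lane engine, KERNEL). -/
theorem psegX_0_29 : Plane.segOK 224 11 (A2h_n224_k12_c3f6e83f.cert.sideX.found.map Prod.fst) A2h_n224_k12_c3f6e83f.pGX_0 5 113 1 47 = true := by
  decide +kernel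

set_option maxHeartbeats 400000000 in
/-- `X` view 0, lane segment `[114, 115)` (6919896 lanes, depth 5, threshold 11; est 27 s): every selection with largest row there passes (lane engine, KERNEL). -/
theorem psegX_0_30 : Plane.segOK 224 11 (A2h_n224_k12_c3f6e83f.cert.sideX.found.map Prod.fst) A2h_n224_k12_c3f6e83f.pGX_0 5 114 1 47 = true := by
  decide +kernel

set_option maxHeartbeats 400000000 in
/-- `X` view 0, lane segment `[115, 116)` (7166916 lanes, depth 5, threshold 11; est 29 s): every selection with largest row there passes (lane engine, KERNEL). -/
theorem psegX_0_31 : Plane.segOK 224 11 (A2h_n224_k12_c3f6e83f.cert.sideX.found.map Prod.fst) A2h_n224_k12_c3f6e83f.pGX_0 5 115 1 47 = true := by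
  decide +kernel

set_option maxHeartbeats 400000000 in
/-- `X` view 0, lane segment `[116, 117)` (7420492 lanes, depth 5, threshold 11; est 29 s): every selection with largest row there passes (lane engine, KERNEL). -/
theorem psegX_0_32 : Plane.segOK 224 11 (A2h_n224_k12_c3f6e83f.cert.sideX.found.map Prod.fst) A2h_n224_k12_c3f6e83f.pGX_0 5 116 1 47 = true := by
  decide +kernel

set_option maxHeartbeats 400000000 in
/-- `X` view 0, lane segment `[117, 118)` (7680739 lanes, depth 5, threshold 11; est 37 s): every selection with largest row there passes (lane engine, KERNEL). -/
theorem psegX_0_33 : Plane.segOK 224 11 (A2h_n224_k12_c3f6e83f.cert.sideX.found.map Prod.fst) A2h_n224_k12_c3f6e83f.pGX_0 5 117 1 47 = true := by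
  decide +kernel

end Summit.Ventures.QEC.Census.A2h_n224_k12_c3f6e83f
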